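import Literature.NumberTheory.EllipticCurves.CongruentNumberCurveMinimalAtTwo
import Literature.NumberTheory.DiophantineGeometry.LocalReductionHasMultiplicativeReductionAtProofs
import HarnessLib

/-!
# Kraus's necessary condition at `2` and additive reduction with `ord₂(Δ_min) = 12`

Sibling file of `Literature.NumberTheory.DiophantineGeometry.LocalReduction` (D-0014 append
protocol; everything here is proved, no definitions). For an elliptic curve over `ℚ₂` the
existence of an *integral* Weierstrass model with prescribed invariants `c₄, c₆` is governed by
Kraus's theorem (A. Kraus, *Quelques remarques à propos des invariants c₄, c₆ et Δ d'une courbe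
elliptique*, Acta Arith. 54 (1989), Prop. 2: an integral model exists iff
`c₆ ≡ -1 (mod 4)`, or `16 ∣ c₄` and `c₆ ≡ 0, 8 (mod 32)`; these are the tests at `p = 2` in the
Laska–Kraus–Connell algorithm, Cremona, *Algorithms*, §3.2, lines 10–11 of the pseudocode,
PDF p. 51 of the held copy). We prove the **necessity** half, which
is elementary (`WeierstrassCurve.kraus_two_of_integral`): for a `2`-adically integral equation,
either `a₁` is odd, and then `b₂ = a₁² + 4a₂ ≡ 1 (mod 4)` gives `c₆ = -b₂³ + 36b₂b₄ - 216b₆ ≡ -1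
(mod 4)`; or `a₁` is even, and then `b₂ ∈ 4𝓞`, `b₄ ∈ 2𝓞` give `c₄ = b₂² - 24b₄ ∈ 16𝓞` and
`c₆ ≡ -216 a₃² (mod 32)`, i.e. `c₆ ≡ 0` or `8 (mod 32)` as `a₃` is even or odd.

Application (`not_hasGoodReductionAt_two_of_c₆_eq_*`): a curve `W / ℚ` with
`ord₂(Δ) = 12` has good reduction at `2` iff some `⟨2w⁻¹, r, s, t⟩ • W` (`w` a `2`-adic unit) is
integral, whose `c₆` is `w⁶ c₆ / 64`; when `c₆ = 64N` with `N ≡ 1 (mod 4)`, or `c₆ = 2⁹L` with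
`L ≡ 3 (mod 4)`, all three of Kraus's alternatives fail (`w⁶ ≡ 1 (mod 8)`), so `W` does **not**
have good reduction at `2`; and if moreover `ord₂(j) ≥ 0` it has additive reduction
(`hasAdditiveReductionAt_of_not_hasGoodReductionAt_of_cube_le`, Silverman VII.5.1). This is the
`2`-adic input for the CM curves `j = 16581375 ~ -3375` and `j = -12288000 ~ 0` twisted by
`d ≡ 3 (mod 4)` (`ComplexMultiplicationLocalFactors28/27`), where `ord₂(Δ_min) = 12` and
Silverman's Remark VII.1.1 is silent.

## References

* A. Kraus, *Quelques remarques à propos des invariants c₄, c₆ et Δ d'une courbe elliptique*,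
  Acta Arith. 54 (1989), 75–80, Prop. 2 (the conditions at `p = 2`; held as
  `doi:10.4064/aa-54-1-75-80`, a scan without text layer — the statement is quoted from
  Cremona's algorithm below). [cite: Kraus1989]
* J. H. Silverman, *The Arithmetic of Elliptic Curves*, 2nd ed. (2009), III.1 (`b₂, b₄, b₆, c₄,
  c₆`, Table 3.1: `c₄' = u⁻⁴c₄`, `c₆' = u⁻⁶c₆`, `Δ' = u⁻¹²Δ`), VII.1, VII.5 Prop. 5.1.
  [cite: SilvermanAEC2009]
* J. E. Cremona, *Algorithms for Modular Elliptic Curves*, 2nd ed. (1997), §3.2, "The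
  Laska–Kraus–Connell algorithm", lines 10–11: `IF a ≡ 1 (mod 2) AND b ≡ -1 (mod 4) … ELIF a ≡ 0
  (mod 16) AND (b ≡ 0 OR b ≡ 8 (mod 32))` with `a = c₄/2^{4d}`, `b = c₆/2^{6d}` (PDF p. 51 of the
  held copy `book:cremona1997-algorithms-modular-elliptic-curves-2nd-ed`).
  [cite: CremonaAlgorithms1997, §3.2 (PDF p. 51)]
-/

noncomputable section

open scoped Classical

open IsDedekindDomain WeierstrassCurve Rat.HeightOneSpectrum Literature.NumberTheory.EllipticCurves

namespace WeierstrassCurve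

section TwoAdic

variable (v : HeightOneSpectrum (NumberField.RingOfIntegers ℚ))

/-- At the place over `2`: `|n|_v ≤ exp(-e)` for `2^e ∣ n`. [folklore] -/
theorem valued_natCast_le_of_dvd (hv : natGenerator v = 2) {n e : ℕ} (h : 2 ^ e ∣ n) :
    Valued.v (n : v.adicCompletion ℚ) ≤ WithZero.exp (-(e : ℤ)) := by
  have h' : (natGenerator v : ℤ) ^ e ∣ (n : ℤ) := by rw [hv]; exact_mod_cast h
  have := Literature.NumberTheory.GaloisRepresentations.Rat.valuation_intCast_le v h'
  rw [← map_natCast (algebraMap ℚ (v.adicCompletion ℚ)) n, valued_algebraMap_adicCompletion]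
  exact_mod_cast this

/-- At the place over `2`: `|n|_v ≤ exp(-e)` for an integer `n` with `2^e ∣ n`. [folklore] -/
theorem valued_intCast_le_of_dvd (hv : natGenerator v = 2) {n : ℤ} {e : ℕ} (h : (2 : ℤ) ^ e ∣ n) :
    Valued.v (algebraMap ℚ (v.adicCompletion ℚ) n) ≤ WithZero.exp (-(e : ℤ)) := by
  have h' : (natGenerator v : ℤ) ^ e ∣ n := by rw [hv]; exact_mod_cast h
  have := Literature.NumberTheory.GaloisRepresentations.Rat.valuation_intCast_le v h'
  rwa [valued_algebraMap_adicCompletion]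

/-- At the place over `2`: an odd integer is a unit. [folklore] -/
theorem valued_intCast_eq_one_of_odd (hv : natGenerator v = 2) {n : ℤ} (h : ¬ (2 : ℤ) ∣ n) :
    Valued.v (algebraMap ℚ (v.adicCompletion ℚ) n) = 1 := by
  rw [valued_algebraMap_adicCompletion]
  exact Literature.NumberTheory.GaloisRepresentations.Rat.valuation_intCast_eq_one v (by rw [hv]; exact_mod_cast h)

/-- `|a|_v < 1 ⇒ |a|_v ≤ exp(-1)` (discreteness). [folklore] -/
theorem valued_le_exp_neg_one_of_lt_one {a : v.adicCompletion ℚ} (h : Valued.v a < 1) :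
    Valued.v a ≤ WithZero.exp (-1 : ℤ) := by
  have := withZero_le_exp_sub_one_of_lt_exp (k := 0) (by rwa [WithZero.exp_zero])
  simpa using this

/-- A `v`-adic integer `a` with `|a - 1|_v < 1` is a unit. [folklore] -/
theorem valued_eq_one_of_valued_sub_one_lt_one {a : v.adicCompletion ℚ}
    (h : Valued.v (a - 1) < 1) : Valued.v a = 1 := by
  have : a = 1 + (a - 1) := by ring
  rw [this, Valuation.map_add_eq_of_lt_left, Valuation.map_one]
  rwa [Valuation.map_one]

/-- `|w|_v = 1 ⇒ |w⁶ - 1|_v ≤ exp(-3)` (`w⁶ - 1 = (w² - 1)(w⁴ + w² + 1)`, squares of `2`-adic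
units are `≡ 1 (mod 8)`). [folklore] -/
theorem valued_pow_six_sub_one_le (hv : natGenerator v = 2) {w : v.adicCompletion ℚ}
    (hw : Valued.v w = 1) : Valued.v (w ^ 6 - 1) ≤ WithZero.exp (-3 : ℤ) := by
  have h2 := valued_sq_sub_one_le_of_valued_eq_one v hv hw
  have hint : Valued.v (w ^ 4 + w ^ 2 + 1) ≤ 1 := by
    refine Valuation.map_add_le _ (Valuation.map_add_le _ ?_ ?_) (by rw [Valuation.map_one])
    · rw [Valuation.map_pow, hw, one_pow]
    · rw [Valuation.map_pow, hw, one_pow]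
  have : w ^ 6 - 1 = (w ^ 2 - 1) * (w ^ 4 + w ^ 2 + 1) := by ring
  rw [this, Valuation.map_mul]
  calc Valued.v (w ^ 2 - 1) * Valued.v (w ^ 4 + w ^ 2 + 1) ≤ WithZero.exp (-3 : ℤ) * 1 :=
        mul_le_mul' h2 hint
    _ = WithZero.exp (-3 : ℤ) := mul_one _

/-- **Kraus's necessary condition at `2`** (Kraus 1989, Prop. 2, necessity). For a `2`-adically
integral Weierstrass equation `M`: either `|c₄|₂ ≤ 2⁻⁴` and (`|c₆|₂ ≤ 2⁻⁵` or
`|c₆ - 8|₂ ≤ 2⁻⁵`) — the case `a₁` even, where `4 ∣ b₂`, `2 ∣ b₄`, so `16 ∣ c₄ = b₂² - 24b₄` and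
`c₆ = -b₂³ + 36b₂b₄ - 216b₆ ≡ -216a₃² ≡ 0, 8 (mod 32)` — or `|c₆ + 1|₂ ≤ 2⁻²` — the case `a₁`
odd, where `b₂ ≡ 1 (mod 4)` and `c₆ ≡ -b₂³ ≡ -1 (mod 4)`.
[cite: Kraus1989, Prop. 2] [cite: CremonaAlgorithms1997, §3.2 (Laska–Kraus–Connell, PDF p. 51)]
[cite: SilvermanAEC2009, III.1 (b₂, b₄, b₆, c₄, c₆)] -/
theorem kraus_two_of_integral (hv : natGenerator v = 2) (M : WeierstrassCurve (v.adicCompletion ℚ))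
    (h₁ : Valued.v M.a₁ ≤ 1) (h₂ : Valued.v M.a₂ ≤ 1) (h₃ : Valued.v M.a₃ ≤ 1)
    (h₄ : Valued.v M.a₄ ≤ 1) (h₆ : Valued.v M.a₆ ≤ 1) :
    (Valued.v M.c₄ ≤ WithZero.exp (-4 : ℤ) ∧
      (Valued.v M.c₆ ≤ WithZero.exp (-5 : ℤ) ∨ Valued.v (M.c₆ - 8) ≤ WithZero.exp (-5 : ℤ))) ∨
      Valued.v (M.c₆ + 1) ≤ WithZero.exp (-2 : ℤ) := by
  have V2 := valued_two v hv
  have V4 := valued_four v hv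
  have V8 : Valued.v (8 : v.adicCompletion ℚ) ≤ WithZero.exp (-3 : ℤ) := by
    simpa using valued_natCast_le_of_dvd v hv (n := 8) (e := 3) (by norm_num)
  have V24 : Valued.v (24 : v.adicCompletion ℚ) ≤ WithZero.exp (-3 : ℤ) := by
    simpa using valued_natCast_le_of_dvd v hv (n := 24) (e := 3) (by norm_num)
  have V36 : Valued.v (36 : v.adicCompletion ℚ) ≤ WithZero.exp (-2 : ℤ) := by
    simpa using valued_natCast_le_of_dvd v hv (n := 36) (e := 2) (by norm_num)
  have V216 : Valued.v (216 : v.adicCompletion ℚ) ≤ WithZero.exp (-3 : ℤ) := by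
    simpa using valued_natCast_le_of_dvd v hv (n := 216) (e := 3) (by norm_num)
  have V224 : Valued.v (224 : v.adicCompletion ℚ) ≤ WithZero.exp (-5 : ℤ) := by
    simpa using valued_natCast_le_of_dvd v hv (n := 224) (e := 5) (by norm_num)
  have V864 : Valued.v (864 : v.adicCompletion ℚ) ≤ WithZero.exp (-5 : ℤ) := by
    simpa using valued_natCast_le_of_dvd v hv (n := 864) (e := 5) (by norm_num)
  -- products of bounds in `ℤᵐ⁰`
  have mul2 : ∀ {x y : v.adicCompletion ℚ} {a b : ℤ}, Valued.v x ≤ WithZero.exp a →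
      Valued.v y ≤ WithZero.exp b → Valued.v (x * y) ≤ WithZero.exp (a + b) := by
    intro x y a b hx hy
    rw [Valuation.map_mul, ← withZero_exp_mul_exp]
    exact mul_le_mul' hx hy
  have hb₆ : Valued.v M.b₆ ≤ 1 := by
    rw [b₆]
    refine Valuation.map_add_le _ ?_ ?_
    · rw [Valuation.map_pow]; exact pow_le_one' h₃ _
    · exact (mul2 V4.le h₆).trans (by rw [← WithZero.exp_zero, WithZero.exp_le_exp]; norm_num)
  rcases valued_lt_one_or_valued_sub_one_lt_one v hv h₁ with ha | ha
  · -- `a₁` even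
    left
    have ha₁ : Valued.v M.a₁ ≤ WithZero.exp (-1 : ℤ) := valued_le_exp_neg_one_of_lt_one v ha
    have hb₂ : Valued.v M.b₂ ≤ WithZero.exp (-2 : ℤ) := by
      rw [b₂]
      refine Valuation.map_add_le _ ?_ ?_
      · rw [pow_two]; simpa using mul2 ha₁ ha₁
      · simpa using mul2 V4.le h₂
    have hb₄ : Valued.v M.b₄ ≤ WithZero.exp (-1 : ℤ) := by
      rw [b₄]
      refine Valuation.map_add_le _ ?_ ?_
      · simpa using mul2 V2.le h₄
      · simpa using mul2 ha₁ h₃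
    refine ⟨?_, ?_⟩
    · -- `c₄ = b₂² - 24 b₄`
      rw [c₄]
      refine Valuation.map_sub_le _ ?_ ?_
      · rw [pow_two]; simpa using mul2 hb₂ hb₂
      · simpa using mul2 V24 hb₄
    · -- `c₆ = -b₂³ + 36 b₂ b₄ - 216 b₆`, `216 b₆ = 216 a₃² + 864 a₆`
      have hR : Valued.v (-M.b₂ ^ 3 + 36 * M.b₂ * M.b₄ - 864 * M.a₆) ≤ WithZero.exp (-5 : ℤ) := by
        refine Valuation.map_sub_le _ (Valuation.map_add_le _ ?_ ?_) ?_
        · rw [Valuation.map_neg, Valuation.map_pow]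
          calc Valued.v M.b₂ ^ 3 ≤ WithZero.exp (-2 : ℤ) ^ 3 := pow_le_pow_left' hb₂ 3
            _ ≤ WithZero.exp (-5 : ℤ) := by
                rw [← WithZero.exp_nsmul, WithZero.exp_le_exp]; norm_num
        · simpa using mul2 (mul2 V36 hb₂) hb₄
        · simpa using mul2 V864 h₆
      have hc₆ : M.c₆ = -(216 * M.a₃ ^ 2) + (-M.b₂ ^ 3 + 36 * M.b₂ * M.b₄ - 864 * M.a₆) := by
        simp only [c₆, b₆]; ring
      rcases valued_lt_one_or_valued_sub_one_lt_one v hv h₃ with ha₃ | ha₃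
      · -- `a₃` even: `c₆ ∈ 32𝓞`
        left
        have ha₃' : Valued.v M.a₃ ≤ WithZero.exp (-1 : ℤ) := valued_le_exp_neg_one_of_lt_one v ha₃
        rw [hc₆]
        refine Valuation.map_add_le _ ?_ hR
        rw [Valuation.map_neg, pow_two]
        simpa using mul2 V216 (mul2 ha₃' ha₃')
      · -- `a₃` odd: `a₃² ≡ 1 (mod 8)`, `c₆ ≡ -216 ≡ 8 (mod 32)`
        right
        have hsq := valued_sq_sub_one_le_of_valued_eq_one v hv
          (valued_eq_one_of_valued_sub_one_lt_one v ha₃)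
        have : M.c₆ - 8 = -(216 * (M.a₃ ^ 2 - 1)) - 224 +
            (-M.b₂ ^ 3 + 36 * M.b₂ * M.b₄ - 864 * M.a₆) := by rw [hc₆]; ring
        rw [this]
        refine Valuation.map_add_le _ (Valuation.map_sub_le _ ?_ V224) hR
        rw [Valuation.map_neg]
        have := mul2 V216 hsq
        exact this.trans (by rw [WithZero.exp_le_exp]; norm_num)
  · -- `a₁` odd: `b₂ ≡ 1 (mod 4)`, `c₆ ≡ -1 (mod 4)`
    right
    have ha₁ : Valued.v M.a₁ = 1 := valued_eq_one_of_valued_sub_one_lt_one v ha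
    have hsq := valued_sq_sub_one_le_of_valued_eq_one v hv ha₁
    have hb₂ : Valued.v (M.b₂ - 1) ≤ WithZero.exp (-2 : ℤ) := by
      have : M.b₂ - 1 = (M.a₁ ^ 2 - 1) + 4 * M.a₂ := by rw [b₂]; ring
      rw [this]
      refine Valuation.map_add_le _ (hsq.trans (by rw [WithZero.exp_le_exp]; norm_num)) ?_
      simpa using mul2 V4.le h₂
    have hb₂' : Valued.v M.b₂ ≤ 1 := by
      have : M.b₂ = (M.b₂ - 1) + 1 := by ring
      rw [this]
      exact Valuation.map_add_le _ (hb₂.trans (by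
        rw [← WithZero.exp_zero, WithZero.exp_le_exp]; norm_num)) (by rw [Valuation.map_one])
    have hb₄ : Valued.v M.b₄ ≤ 1 := by
      rw [b₄]
      refine Valuation.map_add_le _ ?_ ?_
      · have := mul2 V2.le h₄
        exact this.trans (by rw [← WithZero.exp_zero, WithZero.exp_le_exp]; norm_num)
      · simpa [ha₁] using mul2 ha₁.le h₃
    have : M.c₆ + 1 = -((M.b₂ - 1) * (M.b₂ ^ 2 + M.b₂ + 1)) + 36 * M.b₂ * M.b₄ - 216 * M.b₆ := by
      simp only [c₆]; ring
    rw [this]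
    refine Valuation.map_sub_le _ (Valuation.map_add_le _ ?_ ?_) ?_
    · rw [Valuation.map_neg]
      have hq : Valued.v (M.b₂ ^ 2 + M.b₂ + 1) ≤ 1 :=
        Valuation.map_add_le _ (Valuation.map_add_le _
          (by rw [Valuation.map_pow]; exact pow_le_one' hb₂' _) hb₂') (by rw [Valuation.map_one])
      simpa using mul2 hb₂ hq
    · simpa using mul2 (mul2 V36 hb₂') hb₄
    · have := mul2 V216 hb₆
      exact this.trans (by rw [WithZero.exp_le_exp]; norm_num)

end TwoAdic

/-! ## Curves over `ℚ` with `ord₂(Δ) = 12` and no good reduction at `2` -/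

section NoGood

variable (v : HeightOneSpectrum (NumberField.RingOfIntegers ℚ)) (W : WeierstrassCurve ℚ)

/-- **The unit `w = 2u⁻¹` of a good model.** If `W / ℚ` has `|Δ|₂ = 2⁻¹²` and good reduction at
`2`, the chosen minimal model at `2` is `⟨u, r, s, t⟩ • W_{ℚ₂}` with `|u⁻¹|₂ = 2`, it is
`2`-adically integral, and its `c₆ = c` satisfies `64c = w⁶ · c₆(W)` for the unit `w = 2u⁻¹`; by Kraus's
necessary condition one of the three alternatives holds for it. (Silverman VII.1, Table 3.1;
Kraus 1989, Prop. 2.) [cite: Kraus1989, Prop. 2] -/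
theorem exists_unit_kraus_of_hasGoodReductionAt (hv : natGenerator v = 2)
    (hΔ : v.valuation ℚ W.Δ = WithZero.exp (-12 : ℤ)) (hg : W.HasGoodReductionAt v) :
    ∃ w c : v.adicCompletion ℚ, Valued.v w = 1 ∧
      64 * c = w ^ 6 * algebraMap ℚ (v.adicCompletion ℚ) W.c₆ ∧
      ((Valued.v c ≤ WithZero.exp (-5 : ℤ) ∨ Valued.v (c - 8) ≤ WithZero.exp (-5 : ℤ)) ∨
        Valued.v (c + 1) ≤ WithZero.exp (-2 : ℤ)) := by
  set L := v.adicCompletion ℚ with hL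
  set X : WeierstrassCurve L := W.baseChange L with hX
  obtain ⟨C, hC⟩ : ∃ C : VariableChange L, W.localMinimalModel v = C • X := ⟨_, rfl⟩
  have hequiv := isEquiv_valuation_maximalIdeal_valued (K := ℚ) v
  have V2 := valued_two v hv
  have h20 : (2 : L) ≠ 0 := by
    intro h; rw [h, Valuation.map_zero] at V2; exact WithZero.exp_ne_zero V2.symm
  -- `|Δ_M| = 1` with `Δ_M = u⁻¹² Δ`
  have h1 : Valued.v ((C • X).Δ) = 1 := by
    have := hg.goodReduction
    rw [hC] at this
    exact hequiv.eq_one_iff_eq_one.mp this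
  have hXΔ : Valued.v X.Δ = WithZero.exp (-12 : ℤ) := by
    rw [hX, WeierstrassCurve.baseChange, map_Δ, valued_algebraMap_adicCompletion, hΔ]
  rw [variableChange_Δ, Valuation.map_mul, Valuation.map_pow, hXΔ] at h1
  set U : WithZero (Multiplicative ℤ) := Valued.v ((C.u⁻¹ : Lˣ) : L) with hU
  have hU0 : U ≠ 0 := (Valuation.ne_zero_iff _).mpr (Units.ne_zero _)
  have hUe : U = WithZero.exp (1 : ℤ) := by
    rw [← WithZero.exp_log hU0, ← WithZero.exp_nsmul, ← WithZero.exp_add, WithZero.exp_eq_one] at h1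
    rw [← WithZero.exp_log hU0]
    congr 1
    simp only [nsmul_eq_mul, Nat.cast_ofNat] at h1
    omega
  -- the unit `w = 2 u⁻¹`
  set w : L := 2 * ((C.u⁻¹ : Lˣ) : L) with hw
  have hw1 : Valued.v w = 1 := by
    rw [hw, Valuation.map_mul, V2, ← hU, hUe, withZero_exp_mul_exp]
    norm_num
  -- integrality of the minimal model
  haveI : (C • X).IsMinimal (v.adicCompletionIntegers ℚ) := hC ▸ inferInstance
  have hint : (C • X).IsIntegral (v.adicCompletionIntegers ℚ) := inferInstance
  obtain ⟨i1, i2, i3, i4, i6⟩ := (isIntegral_iff_forall_mem_range (C • X)).mp hint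
  have hV1 : ∀ x : L, x ∈ (algebraMap (v.adicCompletionIntegers ℚ) L).range → Valued.v x ≤ 1 :=
    fun x hx ↦ (valued_le_one_iff_mem_range_adicCompletionIntegers v x).mpr hx
  have hK := kraus_two_of_integral v hv (C • X) (hV1 _ i1) (hV1 _ i2) (hV1 _ i3) (hV1 _ i4)
    (hV1 _ i6)
  -- `c₆(M) = u⁻⁶ c₆`, `64 c₆(M) = w⁶ c₆`
  have hc₆ : 64 * (C • X).c₆ = w ^ 6 * algebraMap ℚ L W.c₆ := by
    rw [variableChange_c₆, hX, WeierstrassCurve.baseChange, map_c₆, hw]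
    ring
  refine ⟨w, (C • X).c₆, hw1, hc₆, ?_⟩
  rcases hK with ⟨-, h⟩ | h
  · exact Or.inl h
  · exact Or.inr h

/-- **No good reduction at `2`, type `c₆ = 64N`, `N ≡ 1 (mod 4)`** (with `|Δ|₂ = 2⁻¹²`): for a
unit `w`, `w⁶N` is a unit (so neither `≡ 0` nor `≡ 8 (mod 32)`) and `w⁶N + 1 ≡ 2 (mod 4)`
(`w⁶ ≡ 1 (mod 8)`), contradicting Kraus's necessary condition for the good model.
[cite: Kraus1989, Prop. 2] -/
theorem not_hasGoodReductionAt_two_of_c₆_eq_64_mul (hv : natGenerator v = 2)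
    (hΔ : v.valuation ℚ W.Δ = WithZero.exp (-12 : ℤ)) {N : ℤ} (hN : W.c₆ = 64 * N)
    (hN1 : (4 : ℤ) ∣ N - 1) : ¬ W.HasGoodReductionAt v := by
  intro hg
  obtain ⟨w, c, hw1, hc, hK⟩ := exists_unit_kraus_of_hasGoodReductionAt v W hv hΔ hg
  have V2 := valued_two v hv
  have V8 : Valued.v (8 : v.adicCompletion ℚ) ≤ WithZero.exp (-3 : ℤ) := by
    simpa using valued_natCast_le_of_dvd v hv (n := 8) (e := 3) (by norm_num)
  have hNodd : ¬ (2 : ℤ) ∣ N := fun h ↦ by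
    have : (2 : ℤ) ∣ 1 := by
      have h4 : (2 : ℤ) ∣ N - 1 := (dvd_trans ⟨2, by norm_num⟩ hN1)
      simpa using dvd_sub h h4
    norm_num at this
  set n : v.adicCompletion ℚ := algebraMap ℚ (v.adicCompletion ℚ) N with hn
  have hVN : Valued.v n = 1 := valued_intCast_eq_one_of_odd v hv hNodd
  have hVN1 : Valued.v (n - 1) ≤ WithZero.exp (-2 : ℤ) := by
    have := valued_intCast_le_of_dvd v hv (n := N - 1) (e := 2) (by simpa using hN1)
    rwa [Int.cast_sub, Int.cast_one, map_sub, map_one] at this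
  have h64 : (64 : v.adicCompletion ℚ) ≠ 0 := by
    have h20 : (2 : v.adicCompletion ℚ) ≠ 0 := by
      intro h; rw [h, Valuation.map_zero] at V2; exact WithZero.exp_ne_zero V2.symm
    rw [show (64 : v.adicCompletion ℚ) = 2 ^ 6 by norm_num]; exact pow_ne_zero _ h20
  have he : c = w ^ 6 * n := by
    refine mul_left_cancel₀ h64 ?_
    rw [hc, hN, hn, map_mul, map_ofNat]
    ring
  subst he
  have hunit : Valued.v (w ^ 6 * n) = 1 := by
    rw [Valuation.map_mul, Valuation.map_pow, hw1, one_pow, one_mul, hVN]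
  have hlt : ∀ {k : ℤ}, k < 0 → ¬ (1 : WithZero (Multiplicative ℤ)) ≤ WithZero.exp k := by
    intro k hk h
    rw [← WithZero.exp_zero, WithZero.exp_le_exp] at h
    omega
  rcases hK with (h | h) | h
  · rw [hunit] at h; exact hlt (by norm_num) h
  · -- `w⁶N - 8` is a unit
    have h8 : Valued.v (-8 : v.adicCompletion ℚ) < Valued.v (w ^ 6 * n) := by
      rw [Valuation.map_neg, hunit]
      exact lt_of_le_of_lt V8 (by rw [← WithZero.exp_zero, WithZero.exp_lt_exp]; norm_num)
    have : Valued.v (w ^ 6 * n - 8) = 1 := by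
      rw [sub_eq_add_neg, Valuation.map_add_eq_of_lt_left _ h8, hunit]
    rw [this] at h; exact hlt (by norm_num) h
  · -- `w⁶N + 1 = (w⁶ - 1)N + (N - 1) + 2` has valuation `exp(-1)`
    have h6 := valued_pow_six_sub_one_le v hv hw1
    have hsmall : Valued.v ((w ^ 6 - 1) * n + (n - 1)) ≤ WithZero.exp (-2 : ℤ) := by
      refine Valuation.map_add_le _ ?_ hVN1
      rw [Valuation.map_mul, hVN, mul_one]
      exact h6.trans (by rw [WithZero.exp_le_exp]; norm_num)
    have hlt2 : Valued.v ((w ^ 6 - 1) * n + (n - 1)) < Valued.v (2 : v.adicCompletion ℚ) := by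
      rw [V2]; exact lt_of_le_of_lt hsmall (by rw [WithZero.exp_lt_exp]; norm_num)
    have heq : Valued.v (w ^ 6 * n + 1) = WithZero.exp (-1 : ℤ) := by
      have : w ^ 6 * n + 1 = ((w ^ 6 - 1) * n + (n - 1)) + 2 := by ring
      rw [this, Valuation.map_add_eq_of_lt_right _ hlt2, V2]
    rw [heq, WithZero.exp_le_exp] at h
    norm_num at h

/-- **No good reduction at `2`, type `c₆ = 2⁹L`, `L ≡ 3 (mod 4)`** (with `|Δ|₂ = 2⁻¹²`): for a
unit `w`, `c₆' = 8w⁶L` has `|c₆'|₂ = 2⁻³`, `c₆' - 8 = 8(w⁶L - 1)` with `w⁶L - 1 ≡ 2 (mod 4)`, and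
`c₆' + 1` is a unit, contradicting Kraus's necessary condition for the good model.
[cite: Kraus1989, Prop. 2] -/
theorem not_hasGoodReductionAt_two_of_c₆_eq_512_mul (hv : natGenerator v = 2)
    (hΔ : v.valuation ℚ W.Δ = WithZero.exp (-12 : ℤ)) {N : ℤ} (hN : W.c₆ = 512 * N)
    (hN3 : (4 : ℤ) ∣ N - 3) : ¬ W.HasGoodReductionAt v := by
  intro hg
  obtain ⟨w, c, hw1, hc, hK⟩ := exists_unit_kraus_of_hasGoodReductionAt v W hv hΔ hg
  have V2 := valued_two v hv
  have V8 : Valued.v (8 : v.adicCompletion ℚ) = WithZero.exp (-3 : ℤ) := by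
    rw [show (8 : v.adicCompletion ℚ) = 2 * 2 * 2 by norm_num, Valuation.map_mul,
      Valuation.map_mul, V2, withZero_exp_mul_exp, withZero_exp_mul_exp]
    norm_num
  have hNodd : ¬ (2 : ℤ) ∣ N := fun h ↦ by
    have : (2 : ℤ) ∣ 3 := by
      have h4 : (2 : ℤ) ∣ N - 3 := (dvd_trans ⟨2, by norm_num⟩ hN3)
      simpa using dvd_sub h h4
    norm_num at this
  set n : v.adicCompletion ℚ := algebraMap ℚ (v.adicCompletion ℚ) N with hn
  have hVN : Valued.v n = 1 := valued_intCast_eq_one_of_odd v hv hNodd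
  have hVN3 : Valued.v (n - 3) ≤ WithZero.exp (-2 : ℤ) := by
    have := valued_intCast_le_of_dvd v hv (n := N - 3) (e := 2) (by simpa using hN3)
    rwa [Int.cast_sub, map_sub, show ((3 : ℤ) : ℚ) = 3 by norm_num, map_ofNat] at this
  have h64 : (64 : v.adicCompletion ℚ) ≠ 0 := by
    have h20 : (2 : v.adicCompletion ℚ) ≠ 0 := by
      intro h; rw [h, Valuation.map_zero] at V2; exact WithZero.exp_ne_zero V2.symm
    rw [show (64 : v.adicCompletion ℚ) = 2 ^ 6 by norm_num]; exact pow_ne_zero _ h20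
  set y : v.adicCompletion ℚ := w ^ 6 * n with hy
  have hunit : Valued.v y = 1 := by
    rw [hy, Valuation.map_mul, Valuation.map_pow, hw1, one_pow, one_mul, hVN]
  have he : c = 8 * y := by
    refine mul_left_cancel₀ h64 ?_
    rw [hc, hN, hy, hn, map_mul, map_ofNat]
    ring
  subst he
  rcases hK with (h | h) | h
  · rw [Valuation.map_mul, V8, hunit, mul_one, WithZero.exp_le_exp] at h
    norm_num at h
  · -- `8y - 8 = 8(y - 1)`, `y - 1 = (w⁶ - 1)N + (N - 3) + 2` has valuation `exp(-1)`
    have h6 := valued_pow_six_sub_one_le v hv hw1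
    have hsmall : Valued.v ((w ^ 6 - 1) * n + (n - 3)) ≤ WithZero.exp (-2 : ℤ) := by
      refine Valuation.map_add_le _ ?_ hVN3
      rw [Valuation.map_mul, hVN, mul_one]
      exact h6.trans (by rw [WithZero.exp_le_exp]; norm_num)
    have hlt2 : Valued.v ((w ^ 6 - 1) * n + (n - 3)) < Valued.v (2 : v.adicCompletion ℚ) := by
      rw [V2]; exact lt_of_le_of_lt hsmall (by rw [WithZero.exp_lt_exp]; norm_num)
    have hy1 : Valued.v (y - 1) = WithZero.exp (-1 : ℤ) := by
      have : y - 1 = ((w ^ 6 - 1) * n + (n - 3)) + 2 := by rw [hy]; ring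
      rw [this, Valuation.map_add_eq_of_lt_right _ hlt2, V2]
    have : (8 : v.adicCompletion ℚ) * y - 8 = 8 * (y - 1) := by ring
    rw [this, Valuation.map_mul, V8, hy1, withZero_exp_mul_exp, WithZero.exp_le_exp] at h
    norm_num at h
  · -- `8y + 1` is a unit
    have hlt3 : Valued.v (8 * y) < Valued.v (1 : v.adicCompletion ℚ) := by
      rw [Valuation.map_one, Valuation.map_mul, V8, hunit, mul_one, ← WithZero.exp_zero,
        WithZero.exp_lt_exp]
      norm_num
    have : Valued.v (8 * y + 1) = 1 := by
      rw [Valuation.map_add_eq_of_lt_right _ hlt3, Valuation.map_one]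
    rw [this, ← WithZero.exp_zero, WithZero.exp_le_exp] at h
    norm_num at h

end NoGood

/-! ## Additive reduction from "not good" and `ord(j) ≥ 0` -/

section NotGood

variable {A : Type*} [CommRing A] [IsDedekindDomain A] {K : Type*} [Field K]
  [Algebra A K] [IsFractionRing A K] (v : HeightOneSpectrum A) (W : WeierstrassCurve K)

/-- **Additive reduction from `¬ good` and `|c₄|_v³ ≤ |Δ|_v`.** If the coefficients of `W` are
`v`-integral, `Δ ≠ 0`, `W` does not have good reduction at `v` and `|c₄|³ ≤ |Δ|`
(`ord_v(j) ≥ 0`), then `W` has additive reduction at `v`: by Silverman VII.5 Prop. 5.1 the chosen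
minimal model `M = C • W_{K_v}` has good, multiplicative or additive reduction, and
multiplicative reduction `|c₄(M)| = 1 > |Δ_M|` would give `|Δ| < |c₄|³` (`c₄(M) = u⁻⁴c₄`,
`Δ_M = u⁻¹²Δ`). [cite: SilvermanAEC2009, VII.5 Prop. 5.1 and III.1 Table 3.1] -/
theorem hasAdditiveReductionAt_of_not_hasGoodReductionAt_of_cube_le
    (h₁ : v.valuation K W.a₁ ≤ 1) (h₂ : v.valuation K W.a₂ ≤ 1) (h₃ : v.valuation K W.a₃ ≤ 1)
    (h₄ : v.valuation K W.a₄ ≤ 1) (h₆ : v.valuation K W.a₆ ≤ 1)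
    (hng : ¬ W.HasGoodReductionAt v) (hc₄ : v.valuation K W.c₄ ^ 3 ≤ v.valuation K W.Δ) :
    W.HasAdditiveReductionAt v := by
  have hint : W.IsIntegralAt v := W.isIntegralAt_of_valuation_le_one v h₁ h₂ h₃ h₄ h₆
  set R := v.adicCompletionIntegers K with hR
  set L := v.adicCompletion K with hL
  set X : WeierstrassCurve L := W.baseChange L with hX
  haveI hXint : X.IsIntegral R := hint
  obtain ⟨C, hC⟩ : ∃ C : VariableChange L, W.localMinimalModel v = C • X := ⟨_, rfl⟩
  haveI hmin : (C • X).IsMinimal R := hC ▸ inferInstance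
  have hequiv := isEquiv_valuation_maximalIdeal_valued (K := K) v
  set V : Valuation L (WithZero (Multiplicative ℤ)) := Valued.v with hV
  have hΔX : X.Δ = algebraMap K L W.Δ := by rw [hX, WeierstrassCurve.baseChange, map_Δ]
  have hc₄X : X.c₄ = algebraMap K L W.c₄ := by rw [hX, WeierstrassCurve.baseChange, map_c₄]
  have hVc₄ : V X.c₄ ^ 3 ≤ V X.Δ := by
    rw [hΔX, hc₄X, hV, valued_algebraMap_adicCompletion, valued_algebraMap_adicCompletion]
    exact hc₄
  rcases hasGoodReduction_or_hasMultiplicativeReduction_or_hasAdditiveReduction R (W := C • X)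
    with hg | hm | ha
  · exact absurd (show W.HasGoodReductionAt v by rw [HasGoodReductionAt, hC]; exact hg) hng
  · exfalso
    have h1 : V ((C • X).c₄) = 1 := hequiv.eq_one_iff_eq_one.mp hm.multiplicativeReduction
    have h2 : V ((C • X).Δ) < 1 := hequiv.lt_one_iff_lt_one.mp hm.badReduction
    rw [variableChange_c₄, map_mul, map_pow] at h1
    rw [variableChange_Δ, map_mul, map_pow] at h2
    have h3 : V ((C.u⁻¹ : Lˣ) : L) ^ 12 * V X.c₄ ^ 3 = 1 := by
      rw [show V ((C.u⁻¹ : Lˣ) : L) ^ 12 * V X.c₄ ^ 3 =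
        (V ((C.u⁻¹ : Lˣ) : L) ^ 4 * V X.c₄) ^ 3 by rw [mul_pow, ← pow_mul], h1, one_pow]
    have h4 : V ((C.u⁻¹ : Lˣ) : L) ^ 12 * V X.c₄ ^ 3 ≤ V ((C.u⁻¹ : Lˣ) : L) ^ 12 * V X.Δ :=
      mul_le_mul' le_rfl hVc₄
    rw [h3] at h4
    exact absurd h2 (not_lt.mpr h4)
  · show (W.localMinimalModel v).HasAdditiveReduction R
    rw [hC]
    exact ha

end NotGood

end WeierstrassCurve
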